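import Mathlib.Analysis.SpecialFunctions.Pow.Real
import Mathlib.Algebra.Order.Floor.Defs
import HarnessLib

/-!
# K1loc, line `Spectral` — S-D (first good piece): ONE CUT OF THE LINE REFINEMENT (route (i) of memo v8 §8)

Helper file of the prover lane on the crux `K1LocalisedCascade` (stmt-AnomalousDissipation-19491), route
`SawtoothPulseCascade`, registered line `Cruxes.K1LocalisedCascade.Spectral` (one open stub `stub_highModeConcentration`).
The per-line count of the analytic first good piece (memo v8 §7–§8, route (i)) refines a horizontal chord `s ∈ [u, v]` stage by stage:
on the current piece the relevant backward coordinate `c(s)` is affine up to `E`, `|c(s) − (λs + μ₀)| ≤ E` (`…K1Start.abs_phase_sub_affine_le`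
and its coordinate analogues), and the piece is cut by the flat structure of period `1/(2N)`: components
`[(p/2 − 1/4)/N + ζ, (p/2 + 1/4)/N − ζ]`, corners `(p/2 + 1/4)/N`.  This file performs ONE such cut abstractly (any `N ≥ 1`, `λ ≠ 0`, depths
`ζ₂ + E ≤ ζ₁ < 1/(4N)`), with the children defined through the MODEL affine map so that they are intervals by construction:

* `line_cut` — there are integers `pl ≤ ph + 1` with `ph − pl ≤ 2N|λ|(v − u) + 1 − 4Nζ₁` and, for each `p`, a closed sub-interval
  `[a_p, b_p] ⊆ [u, v]` (empty unless `pl ≤ p ≤ ph`; pairwise disjoint interiors) on which the TRUE coordinate lies in the `ζ₂`-component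
  `p`: `c(s) ∈ [(p/2 − 1/4)/N + ζ₂, (p/2 + 1/4)/N − ζ₂]`; and every `s ∈ [u, v]` outside all `[a_p, b_p]` has its true coordinate within
  `ζ₁ + E` of a corner: `|c(s) − (m/2 + 1/4)/N| < ζ₁ + E` — i.e. lies in the corner zone of depth `ζ₃ = ζ₁ + E` (the bad set of
  `…K1Start.volume_badSet_le_sum` / `…FlatComponents.coe_mem_cornerArcs`).

The count `ph − pl + 1 ≤ 2N|λ|(v−u) + 2` is the straddle-inclusive count of memo v8 §8.  WHAT THIS IS NOT: no iteration over stages (the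
`Q`-recursion, next file) and nothing cascade-specific. [cite: ElgindiLissMattingly2025, §1 (corner strips)] [problem: turb]
-/

-- `Summit.<Summit>.<Problem>`: single-conjunct summit, the duplicate namespace segment is deliberate.
set_option linter.dupNamespace false

noncomputable section

namespace Summit.AnomalousDissipation.AnomalousDissipation.Theorems.SawtoothPulseCascade.K1Start

open Set

/-- **Coverage by the abstract flat structure**: for `N ≥ 1`, `ζ ≥ 0` and any real `t`, either `t` lies in some component
`[(p/2 − 1/4)/N + ζ, (p/2 + 1/4)/N − ζ]` or within `ζ` of a corner `(m/2 + 1/4)/N` (strictly). [folklore] -/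
theorem mem_flatComponent_or_near_corner {N : ℕ} (hN : 0 < N) (ζ t : ℝ) :
    (∃ p : ℤ, t ∈ Icc (((p : ℝ) / 2 - 1 / 4) / N + ζ) (((p : ℝ) / 2 + 1 / 4) / N - ζ)) ∨
      ∃ m : ℤ, |t - ((m : ℝ) / 2 + 1 / 4) / N| < ζ := by
  have hNr : (0 : ℝ) < N := by exact_mod_cast hN
  set p : ℤ := ⌊2 * N * t + 1 / 2⌋ with hp
  have h1 : (p : ℝ) ≤ 2 * N * t + 1 / 2 := Int.floor_le _
  have h2 : 2 * N * t + 1 / 2 < p + 1 := Int.lt_floor_add_one _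
  have hlo : ((p : ℝ) / 2 - 1 / 4) / N ≤ t := by rw [div_le_iff₀ hNr]; linarith
  have hhi : t < ((p : ℝ) / 2 + 1 / 4) / N := by rw [lt_div_iff₀ hNr]; linarith
  by_cases ha : ((p : ℝ) / 2 - 1 / 4) / N + ζ ≤ t
  · by_cases hb : t ≤ ((p : ℝ) / 2 + 1 / 4) / N - ζ
    · exact Or.inl ⟨p, ha, hb⟩
    · right; refine ⟨p, ?_⟩
      push Not at hb
      rw [abs_lt]; constructor <;> linarith
  · right; refine ⟨p - 1, ?_⟩
    push Not at ha
    have e : (((p - 1 : ℤ) : ℝ) / 2 + 1 / 4) / N = ((p : ℝ) / 2 - 1 / 4) / N := by push_cast; ring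
    rw [e, abs_lt]; constructor <;> linarith

/-- **One cut, increasing model.**  Data: `N ≥ 1`; depths `ζ₂ + E ≤ ζ₁`, `0 < ζ₁`; a parent interval `[u, v]`;
a coordinate `c` with `|c(s) − (λs + μ₀)| ≤ E` on `[u, v]`, `λ > 0`.  Conclusion: integers `pl, ph` with
`ph − pl ≤ 2Nλ(v − u) + 1 − 4Nζ₁` and sub-intervals `[a p, b p] ⊆ [u, v]` — empty for `p ∉ [pl, ph]`, pairwise disjoint — on which `c(s)`
lies in the `ζ₂`-component `p`, such that every `s ∈ [u, v]` in no `[a p, b p]` (`pl ≤ p ≤ ph`) has `|c(s) − (m/2 + 1/4)/N| < ζ₁ + E` for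
some `m`. [cite: ElgindiLissMattingly2025, §1 (corner strips)] -/
theorem line_cut_pos {N : ℕ} (hN : 0 < N) {ζ₁ ζ₂ E lam μ₀ u v : ℝ} (hζ : ζ₂ + E ≤ ζ₁)
    (hζ₁ : 0 < ζ₁) (hlam : 0 < lam) {c : ℝ → ℝ} (hc : ∀ s ∈ Icc u v, |c s - (lam * s + μ₀)| ≤ E) :
    ∃ (pl ph : ℤ) (a b : ℤ → ℝ),
      ((ph : ℝ) - pl ≤ 2 * N * lam * (v - u) + 1 - 4 * N * ζ₁) ∧
      (∀ p, Icc (a p) (b p) ⊆ Icc u v) ∧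
      (∀ p, (p < pl ∨ ph < p) → b p < a p) ∧
      (∀ p q, p ≠ q → Disjoint (Icc (a p) (b p)) (Icc (a q) (b q))) ∧
      (∀ p, ∀ s ∈ Icc (a p) (b p), c s ∈ Icc (((p : ℝ) / 2 - 1 / 4) / N + ζ₂) (((p : ℝ) / 2 + 1 / 4) / N - ζ₂)) ∧
      (∀ s ∈ Icc u v, (∃ p, pl ≤ p ∧ p ≤ ph ∧ s ∈ Icc (a p) (b p)) ∨
        ∃ m : ℤ, |c s - ((m : ℝ) / 2 + 1 / 4) / N| < ζ₁ + E) := by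
  have hNr : (0 : ℝ) < N := by exact_mod_cast hN
  -- model components and the children
  set lo : ℤ → ℝ := fun p => ((p : ℝ) / 2 - 1 / 4) / N + ζ₁ with hlo
  set hi : ℤ → ℝ := fun p => ((p : ℝ) / 2 + 1 / 4) / N - ζ₁ with hhi
  set a : ℤ → ℝ := fun p => max u ((lo p - μ₀) / lam) with ha
  set b : ℤ → ℝ := fun p => min v ((hi p - μ₀) / lam) with hb
  set pl : ℤ := ⌈2 * N * (lam * u + μ₀ + ζ₁) - 1 / 2⌉ with hpl
  set ph : ℤ := ⌊2 * N * (lam * v + μ₀ - ζ₁) + 1 / 2⌋ with hph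
  have hpl1 : 2 * N * (lam * u + μ₀ + ζ₁) - 1 / 2 ≤ pl := Int.le_ceil _
  have hpl2 : (pl : ℝ) < 2 * N * (lam * u + μ₀ + ζ₁) - 1 / 2 + 1 := Int.ceil_lt_add_one _
  have hph1 : (ph : ℝ) ≤ 2 * N * (lam * v + μ₀ - ζ₁) + 1 / 2 := Int.floor_le _
  have hph2 : 2 * N * (lam * v + μ₀ - ζ₁) + 1 / 2 < ph + 1 := Int.lt_floor_add_one _
  -- membership in a child controls the model
  have hmodel : ∀ p, ∀ s ∈ Icc (a p) (b p), lo p ≤ lam * s + μ₀ ∧ lam * s + μ₀ ≤ hi p := by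
    intro p s hs
    have h1 : (lo p - μ₀) / lam ≤ s := (le_max_right _ _).trans hs.1
    have h2 : s ≤ (hi p - μ₀) / lam := hs.2.trans (min_le_right _ _)
    rw [div_le_iff₀ hlam] at h1
    rw [le_div_iff₀ hlam] at h2
    constructor <;> linarith
  have hgap : ∀ p q : ℤ, p < q → hi p < lo q := by
    intro p q hpq
    have hpq' : (p : ℝ) + 1 ≤ q := by exact_mod_cast hpq
    simp only [hlo, hhi]
    rw [div_sub' (hc := hNr.ne'), div_add' _ _ _ hNr.ne', div_lt_div_iff_of_pos_right hNr]
    nlinarith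
  refine ⟨pl, ph, a, b, ?_, ?_, ?_, ?_, ?_, ?_⟩
  · -- the count
    linarith
  · -- children inside the parent
    intro p s hs
    exact ⟨(le_max_left _ _).trans hs.1, hs.2.trans (min_le_left _ _)⟩
  · -- empty outside `[pl, ph]`
    rintro p (hp | hp)
    · have hp' : (p : ℝ) ≤ pl - 1 := by exact_mod_cast Int.le_sub_one_of_lt hp
      have hhi' : hi p < lam * u + μ₀ := by
        simp only [hhi]; rw [div_sub' (hc := hNr.ne'), div_lt_iff₀ hNr]; nlinarith
      calc b p ≤ (hi p - μ₀) / lam := min_le_right _ _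
        _ < u := by rw [div_lt_iff₀ hlam]; linarith
        _ ≤ a p := le_max_left _ _
    · have hp' : (ph : ℝ) + 1 ≤ p := by exact_mod_cast hp
      have hlo' : lam * v + μ₀ < lo p := by
        simp only [hlo]; rw [div_add' _ _ _ hNr.ne', lt_div_iff₀ hNr]; nlinarith
      calc b p ≤ v := min_le_left _ _
        _ < (lo p - μ₀) / lam := by rw [lt_div_iff₀ hlam]; linarith
        _ ≤ a p := le_max_right _ _
  · -- disjointness
    intro p q hpq
    rw [Set.disjoint_iff]
    rintro s ⟨hsp, hsq⟩
    rcases lt_or_gt_of_ne hpq with h | h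
    · have h1 := (hmodel p s hsp).2
      have h2 := (hmodel q s hsq).1
      linarith [hgap p q h]
    · have h1 := (hmodel q s hsq).2
      have h2 := (hmodel p s hsp).1
      linarith [hgap q p h]
  · -- the true coordinate on a child
    intro p s hs
    have hsI : s ∈ Icc u v := ⟨(le_max_left _ _).trans hs.1, hs.2.trans (min_le_left _ _)⟩
    have hcs := hc s hsI
    rw [abs_le] at hcs
    obtain ⟨h1, h2⟩ := hmodel p s hs
    simp only [hlo, hhi] at h1 h2
    constructor <;> linarith
  · -- coverage
    intro s hsI
    have hcs := hc s hsI
    rcases mem_flatComponent_or_near_corner hN ζ₁ (lam * s + μ₀) with ⟨p, hp1, hp2⟩ | ⟨m, hm⟩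
    · left
      refine ⟨p, ?_, ?_, ?_, ?_⟩
      · -- `pl ≤ p`: `lo p ≤ λ s + μ₀ ≤ λ v + μ₀` is not needed; use `λ u + μ₀ ≤ λ s + μ₀ ≤ hi p`
        have h : lam * u + μ₀ ≤ ((p : ℝ) / 2 + 1 / 4) / N - ζ₁ := by nlinarith [hsI.1]
        have h' : 2 * N * (lam * u + μ₀ + ζ₁) - 1 / 2 ≤ p := by
          rw [div_sub' (hc := hNr.ne'), le_div_iff₀ hNr] at h; nlinarith
        exact Int.ceil_le.mpr h'
      · have h : ((p : ℝ) / 2 - 1 / 4) / N + ζ₁ ≤ lam * v + μ₀ := by nlinarith [hsI.2]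
        have h' : (p : ℝ) ≤ 2 * N * (lam * v + μ₀ - ζ₁) + 1 / 2 := by
          rw [div_add' _ _ _ hNr.ne', div_le_iff₀ hNr] at h; nlinarith
        exact Int.le_floor.mpr h'
      · refine max_le hsI.1 ?_
        rw [div_le_iff₀ hlam]; simp only [hlo]; linarith
      · refine le_min hsI.2 ?_
        rw [le_div_iff₀ hlam]; simp only [hhi]; linarith
    · right
      refine ⟨m, ?_⟩
      rw [abs_le] at hcs
      rw [abs_lt] at hm ⊢
      constructor <;> linarith [hm.1, hm.2]

/-- **One cut of the line refinement** (either sign of the slope).  Data as in `line_cut_pos` but `λ ≠ 0`.  Conclusion: integers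
`pl, ph` with `ph − pl ≤ 2N|λ|(v − u) + 1 − 4Nζ₁` (so at most `⌊2N|λ|(v−u)+1⌋ + 1` children) and pairwise disjoint sub-intervals
`[a p, b p] ⊆ [u, v]`, empty for `p ∉ [pl, ph]`, on which `c(s)` lies in the `ζ₂`-component `p`, such that every `s ∈ [u, v]` in no child
has `|c(s) − (m/2 + 1/4)/N| < ζ₁ + E` for some `m`. [cite: ElgindiLissMattingly2025, §1 (corner strips)] -/
theorem line_cut {N : ℕ} (hN : 0 < N) {ζ₁ ζ₂ E lam μ₀ u v : ℝ} (hζ : ζ₂ + E ≤ ζ₁)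
    (hζ₁ : 0 < ζ₁) (hlam : lam ≠ 0) {c : ℝ → ℝ} (hc : ∀ s ∈ Icc u v, |c s - (lam * s + μ₀)| ≤ E) :
    ∃ (pl ph : ℤ) (a b : ℤ → ℝ),
      ((ph : ℝ) - pl ≤ 2 * N * |lam| * (v - u) + 1 - 4 * N * ζ₁) ∧
      (∀ p, Icc (a p) (b p) ⊆ Icc u v) ∧
      (∀ p, (p < pl ∨ ph < p) → b p < a p) ∧
      (∀ p q, p ≠ q → Disjoint (Icc (a p) (b p)) (Icc (a q) (b q))) ∧
      (∀ p, ∀ s ∈ Icc (a p) (b p), c s ∈ Icc (((p : ℝ) / 2 - 1 / 4) / N + ζ₂) (((p : ℝ) / 2 + 1 / 4) / N - ζ₂)) ∧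
      (∀ s ∈ Icc u v, (∃ p, pl ≤ p ∧ p ≤ ph ∧ s ∈ Icc (a p) (b p)) ∨
        ∃ m : ℤ, |c s - ((m : ℝ) / 2 + 1 / 4) / N| < ζ₁ + E) := by
  rcases lt_or_gt_of_ne hlam with hneg | hpos
  · -- reflect the parameter: `c' s = c (−s)` on `[−v, −u]` with slope `−λ > 0`
    have hc' : ∀ s ∈ Icc (-v) (-u), |c (-s) - (-lam * s + μ₀)| ≤ E := by
      intro s hs
      have h := hc (-s) ⟨by linarith [hs.2], by linarith [hs.1]⟩
      rwa [show lam * -s + μ₀ = -lam * s + μ₀ by ring] at h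
    obtain ⟨pl, ph, a', b', hcount, hsub, hempty, hdisj, htrue, hcover⟩ :=
      line_cut_pos hN hζ hζ₁ (by linarith : 0 < -lam) hc'
    refine ⟨pl, ph, fun p => -b' p, fun p => -a' p, ?_, ?_, ?_, ?_, ?_, ?_⟩
    · rw [abs_of_neg hneg]; linarith
    · intro p s hs
      simp only [mem_Icc] at hs
      have h := hsub p (show -s ∈ Icc (a' p) (b' p) from ⟨by linarith [hs.2], by linarith [hs.1]⟩)
      exact ⟨by linarith [h.2], by linarith [h.1]⟩
    · intro p hp; have := hempty p hp; simp only; linarith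
    · intro p q hpq
      rw [Set.disjoint_iff]
      rintro s ⟨hsp, hsq⟩
      simp only [mem_Icc] at hsp hsq
      have h' := (Set.disjoint_iff.mp (hdisj p q hpq)) (show -s ∈ Icc (a' p) (b' p) ∩ Icc (a' q) (b' q) from
        ⟨⟨by linarith [hsp.2], by linarith [hsp.1]⟩, ⟨by linarith [hsq.2], by linarith [hsq.1]⟩⟩)
      exact (Set.notMem_empty _ h').elim
    · intro p s hs
      simp only [mem_Icc] at hs
      have h := htrue p (-s) ⟨by linarith [hs.2], by linarith [hs.1]⟩
      rwa [neg_neg] at h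
    · intro s hs
      rcases hcover (-s) ⟨by linarith [hs.2], by linarith [hs.1]⟩ with ⟨p, h1, h2, h3⟩ | ⟨m, hm⟩
      · refine Or.inl ⟨p, h1, h2, ?_⟩
        simp only [mem_Icc] at h3 ⊢
        exact ⟨by linarith [h3.2], by linarith [h3.1]⟩
      · right; exact ⟨m, by rwa [neg_neg] at hm⟩
  · have h := line_cut_pos hN hζ hζ₁ hpos hc
    rwa [abs_of_pos hpos]

end Summit.AnomalousDissipation.AnomalousDissipation.Theorems.SawtoothPulseCascade.K1Start
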